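import Summits.HubbardSuperconductivity.HubbardSuperconductivity.Theorems.NodalWardXYVisonPairCostDefs

/-!
# Gauge-mirror identity: crux `VisonPairCost` (stmt-HubbardSuperconductivity-1266), line `Sketch`, stub `stub_gaugeMirror`

The exact finite-dimensional "gauge-mirror" determinant identity `GaugeMirrorIdentity` (statement (5) of
`NodalWardXYVisonPairCostDefs`), pure `Matrix` linear algebra.

Setting. `M₀` Hermitian, `U` a diagonal `±1` matrix (`U * U = 1`), `V := U M₀ U − M₀`, diagonal `0/1`
projections `P_A, P_B` with `V = V_A + V_B`, `V_A := P_A V P_A`, `V_B := P_B V P_B`, `z := it`, `t ≠ 0`,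
`S := M₀ + z`, `G := S⁻¹`, `G' := U G U`.

Proof (block-free).
* `S` is invertible: `−z ∉ spectrum ℂ M₀` because the spectrum of a Hermitian matrix is real
  (`Matrix.IsHermitian.spectrum_eq_image_range`).
* Gauge relations: `U S U = S_V := M₀ + V + z` and `U S_A U = S_B` (`S_A := M₀ + V_A + z`,
  `S_B := M₀ + V_B + z`), using `U V U = −V`, `U P_A = P_A U`; hence `det S_V = det S`, `det S_B = det S_A`
  (`det U · det U = 1`), and `G' = S_V⁻¹`.
* Resolvent identity `G V G' = G − G'`, whence the factorisation
  `1 + G V_B G' V_A = (1 + G V_A)(1 − G' V_A)`.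
* `det S · det(1 + G V_A) = det S_A` and `det S_V · det(1 − G' V_A) = det(S_V − V_A) = det S_B`.
* Sylvester (`Matrix.det_one_add_mul_comm`) and `V_A P_A = V_A`:
  `det(1 + P_A G V_B G' V_A P_A) = det(1 + G V_B G' V_A)`.
* Altogether `det S_A · det S_A = det S · det S · det(1 + P_A G V_B G' V_A P_A)`; take norms.
-/

noncomputable section

-- `Summit.HubbardSuperconductivity.HubbardSuperconductivity.…` is the tree's summit/sub-problem namespace (D-0017).
set_option linter.dupNamespace false

namespace Summit.HubbardSuperconductivity.HubbardSuperconductivity.Theorems.VisonPairCost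

open Matrix

/-- For a Hermitian matrix `M` and `z ∈ ℂ` off the real axis, `M + z • 1` has invertible determinant
(the spectrum of a Hermitian matrix is real). -/
private theorem gm_isUnit_det_add_smul_one {n : Type*} [Fintype n] [DecidableEq n]
    {M : Matrix n n ℂ} (hM : M.IsHermitian) {z : ℂ} (hz : z.im ≠ 0) :
    IsUnit (M + z • (1 : Matrix n n ℂ)).det := by
  have hnot : -z ∉ spectrum ℂ M := by
    rw [hM.spectrum_eq_image_range]
    rintro ⟨r, -, hr⟩
    apply hz
    have h := congrArg RCLike.im hr
    simp at h
    linarith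
  have h := spectrum.notMem_iff.mp hnot
  rw [Algebra.algebraMap_eq_smul_one, neg_smul,
    show -(z • (1 : Matrix n n ℂ)) - M = -(M + z • 1) by abel, IsUnit.neg_iff,
    Matrix.isUnit_iff_isUnit_det] at h
  exact h

/-- The algebraic core of the gauge-mirror identity, for an arbitrary spectral parameter `z` at which
`M₀ + z` is invertible: `det S_A · det S_A = det S · det S · det(1 + P_A G V_B G' V_A P_A)`. -/
private theorem gm_det_identity {n : Type*} [Fintype n] [DecidableEq n]
    (M₀ U V PA PB : Matrix n n ℂ) (z : ℂ)
    (hUU : U * U = 1) (hV : V = U * M₀ * U - M₀) (hUPA : U * PA = PA * U)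
    (hPAPA : PA * PA = PA) (hsplit : V = PA * V * PA + PB * V * PB)
    (hS : IsUnit (M₀ + z • (1 : Matrix n n ℂ)).det) :
    (M₀ + PA * V * PA + z • (1 : Matrix n n ℂ)).det * (M₀ + PA * V * PA + z • (1 : Matrix n n ℂ)).det =
      (M₀ + z • (1 : Matrix n n ℂ)).det * (M₀ + z • (1 : Matrix n n ℂ)).det *
        (1 + PA * (M₀ + z • (1 : Matrix n n ℂ))⁻¹ * (PB * V * PB) *
          (U * (M₀ + z • (1 : Matrix n n ℂ))⁻¹ * U) * (PA * V * PA) * PA).det := by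
  set S : Matrix n n ℂ := M₀ + z • (1 : Matrix n n ℂ) with hSdef
  set G : Matrix n n ℂ := S⁻¹ with hGdef
  set VA : Matrix n n ℂ := PA * V * PA with hVAdef
  set VB : Matrix n n ℂ := PB * V * PB with hVBdef
  set G' : Matrix n n ℂ := U * G * U with hG'def
  set SV : Matrix n n ℂ := M₀ + V + z • (1 : Matrix n n ℂ) with hSVdef
  set SA : Matrix n n ℂ := M₀ + VA + z • (1 : Matrix n n ℂ) with hSAdef
  set SB : Matrix n n ℂ := M₀ + VB + z • (1 : Matrix n n ℂ) with hSBdef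
  -- inverses and absorption rules
  have hSG : S * G = 1 := Matrix.mul_nonsing_inv S hS
  have hGS : G * S = 1 := Matrix.nonsing_inv_mul S hS
  have hUU' : ∀ X : Matrix n n ℂ, U * (U * X) = X := fun X => by
    rw [← mul_assoc, hUU, one_mul]
  have hSG' : ∀ X : Matrix n n ℂ, S * (G * X) = X := fun X => by
    rw [← mul_assoc, hSG, one_mul]
  have hGS' : ∀ X : Matrix n n ℂ, G * (S * X) = X := fun X => by
    rw [← mul_assoc, hGS, one_mul]
  -- gauge relation `U S U = S_V`, so that `G' = S_V⁻¹`
  have hUMU : U * M₀ * U = M₀ + V := by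
    rw [hV]; abel
  have hUSU : U * S * U = SV := by
    rw [hSdef, mul_add, add_mul, hUMU, mul_smul_comm, mul_one, smul_mul_assoc, hUU]
  have hSVG' : SV * G' = 1 := by
    rw [← hUSU, hG'def]; simp only [mul_assoc, hUU', hSG', hUU]
  have hG'SV : G' * SV = 1 := by
    rw [← hUSU, hG'def]; simp only [mul_assoc, hUU', hGS', hUU]
  -- resolvent identity
  have hres : G * V * G' = G - G' := by
    have hVSS : V = SV - S := by
      rw [hSVdef, hSdef]; abel
    rw [hVSS, mul_sub, sub_mul, mul_assoc G SV G', hSVG', mul_one, hGS, one_mul]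
  have hVB : VB = V - VA := by
    rw [hsplit]; abel
  -- the key factorisation
  have hfac : 1 + G * VB * G' * VA = (1 + G * VA) * (1 - G' * VA) := by
    have h1 : G * VB * G' = G - G' - G * VA * G' := by
      rw [hVB, mul_sub, sub_mul, hres]
    rw [h1]
    simp only [add_mul, mul_sub, sub_mul, one_mul, mul_one, mul_assoc]
    abel
  -- determinants
  have hdetU : U.det * U.det = 1 := by
    rw [← det_mul, hUU, det_one]
  have hdetSV : SV.det = S.det := by
    rw [← hUSU, det_mul, det_mul, mul_right_comm, hdetU, one_mul]
  have hSVA : S + VA = SA := by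
    rw [hSdef, hSAdef]; abel
  have hdetA : S.det * (1 + G * VA).det = SA.det := by
    rw [← det_mul, mul_add, mul_one, hSG', hSVA]
  have hSVVA : SV - VA = SB := by
    rw [hSVdef, hSBdef, hVB]; abel
  have hdetB : SV.det * (1 - G' * VA).det = SB.det := by
    rw [← det_mul, mul_sub, mul_one, ← mul_assoc, hSVG', one_mul, hSVVA]
  -- gauge relation `U S_A U = S_B`
  have hUVU : U * V * U = -V := by
    rw [hV]
    simp only [mul_sub, sub_mul, mul_assoc, hUU', hUU, mul_one]
    abel
  have hUVAU : U * VA * U = -VA := by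
    rw [hVAdef]
    calc U * (PA * V * PA) * U = U * PA * V * (PA * U) := by simp only [mul_assoc]
      _ = PA * U * V * (U * PA) := by rw [hUPA]
      _ = PA * (U * V * U) * PA := by simp only [mul_assoc]
      _ = -(PA * V * PA) := by rw [hUVU, mul_neg, neg_mul]
  have hUSAU : U * SA * U = SB := by
    rw [hSAdef, mul_add, mul_add, add_mul, add_mul, hUMU, hUVAU, mul_smul_comm, mul_one,
      smul_mul_assoc, hUU, ← hSVVA, hSVdef]
    abel
  have hdetAB : SB.det = SA.det := by
    rw [← hUSAU, det_mul, det_mul, mul_right_comm, hdetU, one_mul]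
  -- Sylvester
  have hVAPA : VA * PA = VA := by
    rw [hVAdef, mul_assoc (PA * V) PA PA, hPAPA]
  have hT : PA * G * VB * G' * VA * PA = PA * (G * VB * G' * VA) := by
    rw [mul_assoc _ VA PA, hVAPA]; simp only [mul_assoc]
  rw [hT, det_one_add_mul_comm, mul_assoc _ VA PA, hVAPA, hfac, det_mul]
  calc SA.det * SA.det = SA.det * SB.det := by rw [hdetAB]
    _ = S.det * (1 + G * VA).det * (SV.det * (1 - G' * VA).det) := by rw [hdetA, hdetB]
    _ = S.det * S.det * ((1 + G * VA).det * (1 - G' * VA).det) := by rw [hdetSV]; ring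

/-- **Gauge-mirror identity** (registered stub `stub_gaugeMirror` of the line `Sketch`): for Hermitian `M₀`,
a `±1` diagonal `U`, `V = U M₀ U − M₀` splitting as `P_A V P_A + P_B V P_B` over disjoint index sets, and
`t > 0`, `‖det(M₀ + P_A V P_A + it)‖² = ‖det(M₀ + it)‖² · ‖det(1 + P_A G (P_B V P_B) G' (P_A V P_A) P_A)‖`
with `G = (M₀ + it)⁻¹`, `G' = U G U`. -/
theorem stub_gaugeMirror : GaugeMirrorIdentity := by
  intro n _ _ M₀ hM ω A B _hAB U V PA PB hV t ht G G'
  have hU : U = Matrix.diagonal fun i => if ω i then (-1 : ℂ) else 1 := rfl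
  have hPA : PA = Matrix.diagonal fun i => if i ∈ A then (1 : ℂ) else 0 := rfl
  have hUU : U * U = 1 := by
    rw [hU, diagonal_mul_diagonal, ← diagonal_one]
    congr 1; funext i; split_ifs <;> norm_num
  have hUPA : U * PA = PA * U := by
    rw [hU, hPA, diagonal_mul_diagonal, diagonal_mul_diagonal]
    congr 1; funext i; ring
  have hPAPA : PA * PA = PA := by
    rw [hPA, diagonal_mul_diagonal]
    congr 1; funext i; split_ifs <;> norm_num
  have hz : ((t : ℂ) * Complex.I).im ≠ 0 := by
    simp [ht.ne']
  have key := gm_det_identity M₀ U V PA PB ((t : ℂ) * Complex.I) hUU rfl hUPA hPAPA hV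
    (gm_isUnit_det_add_smul_one hM hz)
  have hnorm := congrArg (fun w : ℂ => ‖w‖) key
  simp only [norm_mul] at hnorm
  rw [sq, sq]
  exact hnorm

end Summit.HubbardSuperconductivity.HubbardSuperconductivity.Theorems.VisonPairCost

end
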